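import Literature.MathematicalPhysics.QuantumFieldTheory.ConformalBootstrap3D.PointKernelK34v2Data
import Literature.MathematicalPhysics.QuantumFieldTheory.ConformalBootstrap3D.PointKernelParts

/-!
# K34v2 certificate, kernel part file P62: one-cell head segments 167, 168, 169 in level ranges

The head cells whose kernel evaluation exceeds one `decide` are one-cell segments of `hsegsK34v2`; each is
checked by `PCert.hPartSideOK` (side conditions) and `PCert.hPartOK` per level range `[n_lo, n_lo + count)`
against an integer claim, the claims summing to `≥ 0` (`PointKernel.partsOK`); soundness is
`PCert.hParts_sound` (`PointKernelParts`).  The part files `P1, P2, …` are mutually independent (each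
imports only the data file); the ranges of one cell may span several of them, and the per-cell
conclusions `hparts_i` / `hcell_i` of those cells are assembled in `PointKernelK34v2.lean`.
Estimated kernel time 258 s.
-/

set_option maxRecDepth 100000
set_option maxHeartbeats 0

namespace Literature.MathematicalPhysics.QuantumFieldTheory.ConformalBootstrap3D.PointKernelK34v2

open Literature.MathematicalPhysics.QuantumFieldTheory.ConformalBootstrap3D.PointKernel

/-- levels `[31, 44)` of segment 167: partial lower sum `≥` claim. [folklore] -/
theorem part_167_1 : certK34v2.hPartOK (PCert.segAt hsegsK34v2 167) JHK34v2 31 13 (18699669664052763654007193126799996922) = true := by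
  decide +kernel

/-- levels `[44, 49)` of segment 167: partial lower sum `≥` claim. [folklore] -/
theorem part_167_2 : certK34v2.hPartOK (PCert.segAt hsegsK34v2 167) JHK34v2 44 5 (2609891775808066645646907852772410280) = true := by
  decide +kernel

/-- one-cell segment 168 (row 6, cell `[1799/256, 3599/512]`, chord, `n_F = 48`,
3 level ranges): side conditions. [folklore] -/
theorem pside_168 : certK34v2.hPartSideOK (PCert.segAt hsegsK34v2 168) JHK34v2 = true := by
  decide +kernel

/-- its level ranges `(n_lo, count, claim)`. [folklore] -/
def parts_168 : List (ℕ × ℕ × ℤ) := [(0, 31, -20967038171618010561212309283981728093), (31, 13, 18538481565951277922606977360208205750), (44, 5, 2428556605666732638605331923773522343)]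

/-- the ranges tile `[0, n_F]` and the claims sum to `≥ 0`. [folklore] -/
theorem pcov_168 : PointKernel.partsOK 48 parts_168 = true := by
  decide +kernel

/-- levels `[0, 31)` of segment 168: partial lower sum `≥` claim. [folklore] -/
theorem part_168_0 : certK34v2.hPartOK (PCert.segAt hsegsK34v2 168) JHK34v2 0 31 (-20967038171618010561212309283981728093) = true := by
  decide +kernel

/-- levels `[31, 44)` of segment 168: partial lower sum `≥` claim. [folklore] -/
theorem part_168_1 : certK34v2.hPartOK (PCert.segAt hsegsK34v2 168) JHK34v2 31 13 (18538481565951277922606977360208205750) = true := by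
  decide +kernel

/-- levels `[44, 49)` of segment 168: partial lower sum `≥` claim. [folklore] -/
theorem part_168_2 : certK34v2.hPartOK (PCert.segAt hsegsK34v2 168) JHK34v2 44 5 (2428556605666732638605331923773522343) = true := by
  decide +kernel

/-- one-cell segment 169 (row 6, cell `[3599/512, 225/32]`, chord, `n_F = 48`,
3 level ranges): side conditions. [folklore] -/
theorem pside_169 : certK34v2.hPartSideOK (PCert.segAt hsegsK34v2 169) JHK34v2 = true := by
  decide +kernel

/-- its level ranges `(n_lo, count, claim)`. [folklore] -/
def parts_169 : List (ℕ × ℕ × ℤ) := [(0, 31, -20624472608197068219463053350984245404), (31, 13, 18377281547108376431513423211346872552), (44, 5, 2247191061088691787949630139637372854)]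

/-- the ranges tile `[0, n_F]` and the claims sum to `≥ 0`. [folklore] -/
theorem pcov_169 : PointKernel.partsOK 48 parts_169 = true := by
  decide +kernel

end Literature.MathematicalPhysics.QuantumFieldTheory.ConformalBootstrap3D.PointKernelK34v2
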